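import Mathlib

/-!
# The combinatorial core of «S4-faces ⟹ S4»: a closure principle for multisets generated by pieces

Blind re-derivation cell `pub-hodge-repro`, seat `night-3`.  Mathlib only.  Namespace `HodgeRepro.Night3.Abstract`.

The route (route/ROUTE.md §3.6 [v2.39]; route/lattice-lead-g18/LEMMA-L-P-v2.md) reduces the open statement S4 to its
rank-four faces through Lemma L (the zero-sum lattice of CM types is generated by conjugate pairs and census faces) and
Lemma P (algebraicity transfers along corner products: product closure and cancellation).  Stripped of every CM-specific
word, the argument is the following statement about multisets over an arbitrary type `α`:

* `toVec M : α → ℤ` is the count vector of a multiset `M`; it is additive and injective;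
* given a set `P` of «piece» multisets and a submodule `Z ≤ (α → ℤ)` (the «zero-sum lattice») with
  `Submodule.span ℤ (toVec '' P) = Z` — LEMMA L, taken as a HYPOTHESIS — every multiset `M` with `toVec M ∈ Z` satisfies
  `M + N ∈ closure P` for some `N ∈ closure P` (`exists_pieces_add_pieces`: the «Consequence» of LEMMA-L-P-v2.md);
* hence (`alg_of_pieces`) every predicate `Alg` on multisets that is closed under sums and under cancellation on
  `Z`-multisets (LEMMA P, steps (1) and (2)–(3), taken as HYPOTHESES) and holds on every piece holds on every `Z`-multiset.

The CM instances — `α = CMType m` (sign vectors), `P` = conjugate pairs and census faces, `Z = zeroSum m`, Lemma L =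
typer-2's `FaceLattice.span_pairs_faces_eq_zeroSum` (every `m ≥ 1`) or night-3's engine certificate (`m ≤ 8`) — and the
transport to the cell's `(G, c)` model live in the files that import this one (`Night3FacePieces`, `Night3FaceClosure`,
`Night3FaceClosureEngine`, `Night3FaceClosureGSet`).  Nothing here is a sealed-statement proof; no Tier-2 item depends on it.
-/

set_option autoImplicit false

namespace HodgeRepro.Night3.Abstract

variable {α : Type*} [DecidableEq α]

/-! ### Count vectors of multisets -/

/-- The count vector of a multiset: `a ↦` the multiplicity of `a` in `M`. -/
def toVec (M : Multiset α) : α → ℤ := fun a => (M.count a : ℤ)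

/-- `toVec` evaluated. -/
theorem toVec_apply (M : Multiset α) (a : α) : toVec M a = M.count a := rfl

/-- The count vector of the empty multiset. -/
theorem toVec_zero : toVec (0 : Multiset α) = 0 := by
  funext a; simp [toVec]

/-- The count vector of a sum of multisets. -/
theorem toVec_add (M N : Multiset α) : toVec (M + N) = toVec M + toVec N := by
  funext a; simp [toVec, Multiset.count_add]

/-- The count vector of a singleton is a basis vector. -/
theorem toVec_singleton (a : α) : toVec ({a} : Multiset α) = Pi.single a 1 := by
  funext b
  rw [toVec_apply, Multiset.count_singleton, Pi.single_apply]
  split_ifs <;> simp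

/-- The count vector of `a ::ₘ M`. -/
theorem toVec_cons (a : α) (M : Multiset α) : toVec (a ::ₘ M) = Pi.single a 1 + toVec M := by
  rw [← Multiset.singleton_add, toVec_add, toVec_singleton]

/-- Count vectors are non-negative. -/
theorem toVec_nonneg (M : Multiset α) (a : α) : 0 ≤ toVec M a := by
  rw [toVec_apply]; exact Nat.cast_nonneg _

/-- A multiset is determined by its count vector. -/
theorem toVec_injective : Function.Injective (toVec (α := α)) := by
  intro M N h
  refine Multiset.ext' fun a => ?_
  have := congrFun h a
  simpa [toVec] using this

/-- `toVec` as an additive monoid homomorphism. -/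
def toVecHom : Multiset α →+ (α → ℤ) where
  toFun := toVec
  map_zero' := toVec_zero
  map_add' := toVec_add

/-- `toVecHom` evaluated. -/
@[simp] theorem toVecHom_apply (M : Multiset α) : toVecHom M = toVec M := rfl

/-! ### Pieces, piece sums, and the image of the piece closure -/

variable (P : Set (Multiset α))

/-- `M` is a SUM OF PIECES: an element of the additive monoid generated by `P` (an ℕ-combination of pieces). -/
def IsPieceSum (M : Multiset α) : Prop := M ∈ AddSubmonoid.closure P

/-- The count vector of a multiset is an ℕ-combination of the pieces' count vectors iff the multiset is a sum of pieces. -/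
theorem toVec_mem_closure_iff (M : Multiset α) :
    toVec M ∈ AddSubmonoid.closure (toVec '' P) ↔ IsPieceSum P M := by
  have himage : toVec '' P = (toVecHom (α := α)) '' P := rfl
  rw [himage, ← AddMonoidHom.map_mclosure, AddSubmonoid.mem_map]
  constructor
  · rintro ⟨N, hN, hNM⟩
    have : N = M := toVec_injective hNM
    subst this
    exact hN
  · intro h
    exact ⟨M, h, rfl⟩

/-- Every ℕ-combination of the pieces' count vectors is the count vector of a sum of pieces. -/
theorem exists_isPieceSum_of_mem_closure {y : α → ℤ} (hy : y ∈ AddSubmonoid.closure (toVec '' P)) :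
    ∃ N : Multiset α, IsPieceSum P N ∧ toVec N = y := by
  have himage : toVec '' P = (toVecHom (α := α)) '' P := rfl
  rw [himage, ← AddMonoidHom.map_mclosure, AddSubmonoid.mem_map] at hy
  obtain ⟨N, hN, hNy⟩ := hy
  exact ⟨N, hN, hNy⟩

/-- An element of the `ℤ`-span of a set is a difference of two ℕ-combinations of the set. -/
theorem exists_closure_sub_closure_of_mem_span {A : Type*} [AddCommGroup A] {S : Set A} {x : A}
    (hx : x ∈ Submodule.span ℤ S) :
    ∃ a ∈ AddSubmonoid.closure S, ∃ b ∈ AddSubmonoid.closure S, x = a - b := by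
  induction hx using Submodule.span_induction with
  | mem s hs => exact ⟨s, AddSubmonoid.subset_closure hs, 0, zero_mem _, (sub_zero s).symm⟩
  | zero => exact ⟨0, zero_mem _, 0, zero_mem _, (sub_zero 0).symm⟩
  | add x y _ _ ihx ihy =>
    obtain ⟨a, ha, b, hb, rfl⟩ := ihx
    obtain ⟨c, hc, d, hd, rfl⟩ := ihy
    exact ⟨a + c, add_mem ha hc, b + d, add_mem hb hd, by abel⟩
  | smul c x _ ih =>
    obtain ⟨a, ha, b, hb, rfl⟩ := ih
    obtain ⟨n, rfl | rfl⟩ := Int.eq_nat_or_neg c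
    · exact ⟨n • a, nsmul_mem ha n, n • b, nsmul_mem hb n, by rw [natCast_zsmul, smul_sub]⟩
    · exact ⟨n • b, nsmul_mem hb n, n • a, nsmul_mem ha n, by rw [neg_zsmul, natCast_zsmul, smul_sub, neg_sub]⟩

/-! ### The zero-sum lattice as a hypothesis, and the Consequence of Lemma L -/

variable (Z : Submodule ℤ (α → ℤ))

/-- `M` is a `Z`-MULTISET: its count vector lies in the lattice `Z`. -/
def IsZeroSumIn (M : Multiset α) : Prop := toVec M ∈ Z

/-- The empty multiset is a `Z`-multiset. -/
theorem isZeroSumIn_zero : IsZeroSumIn Z (0 : Multiset α) := by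
  unfold IsZeroSumIn; rw [toVec_zero]; exact Submodule.zero_mem _

/-- Sums of `Z`-multisets are `Z`-multisets. -/
theorem IsZeroSumIn.add {M N : Multiset α} (hM : IsZeroSumIn Z M) (hN : IsZeroSumIn Z N) : IsZeroSumIn Z (M + N) := by
  unfold IsZeroSumIn at *; rw [toVec_add]; exact Submodule.add_mem _ hM hN

/-- A summand of a `Z`-multiset whose complement is a `Z`-multiset is a `Z`-multiset. -/
theorem IsZeroSumIn.of_add {M N : Multiset α} (hMN : IsZeroSumIn Z (M + N)) (hN : IsZeroSumIn Z N) : IsZeroSumIn Z M := by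
  unfold IsZeroSumIn at *
  rw [toVec_add] at hMN
  simpa using Submodule.sub_mem _ hMN hN

/-- When the pieces are `Z`-multisets, so is every sum of pieces. -/
theorem IsPieceSum.isZeroSumIn (hP : ∀ p ∈ P, IsZeroSumIn Z p) {M : Multiset α} (hM : IsPieceSum P M) :
    IsZeroSumIn Z M := by
  induction hM using AddSubmonoid.closure_induction with
  | mem N hN => exact hP N hN
  | zero => exact isZeroSumIn_zero Z
  | add M N _ _ ihM ihN => exact ihM.add Z ihN

/-- **The Consequence of Lemma L, in the abstract**: if the pieces' count vectors span the lattice `Z` over `ℤ`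
(`hL`, Lemma L), then for every `Z`-multiset `M` there is a sum of pieces `N` such that `M + N` is a sum of pieces. -/
theorem exists_pieces_add_pieces (hL : Submodule.span ℤ (toVec '' P) = Z) {M : Multiset α} (hM : IsZeroSumIn Z M) :
    ∃ N : Multiset α, IsPieceSum P N ∧ IsPieceSum P (M + N) := by
  have hx : toVec M ∈ Submodule.span ℤ (toVec '' P) := by rw [hL]; exact hM
  obtain ⟨a, ha, b, hb, hab⟩ := exists_closure_sub_closure_of_mem_span hx
  obtain ⟨N, hN, rfl⟩ := exists_isPieceSum_of_mem_closure P hb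
  refine ⟨N, hN, ?_⟩
  rw [← toVec_mem_closure_iff, toVec_add, hab, sub_add_cancel]
  exact ha

/-! ### The closure principle -/

/-- A predicate closed under sums of `Z`-multisets that holds on the empty multiset and on every piece holds on every
sum of pieces. -/
theorem alg_of_isPieceSum (hP : ∀ p ∈ P, IsZeroSumIn Z p) (Alg : Multiset α → Prop)
    (hadd : ∀ M N, IsZeroSumIn Z M → IsZeroSumIn Z N → Alg M → Alg N → Alg (M + N))
    (hzero : Alg 0) (hpiece : ∀ p ∈ P, Alg p) {M : Multiset α} (hM : IsPieceSum P M) : Alg M := by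
  induction hM using AddSubmonoid.closure_induction with
  | mem N hN => exact hpiece N hN
  | zero => exact hzero
  | add M N hM hN ihM ihN =>
    exact hadd M N (IsPieceSum.isZeroSumIn P Z hP hM) (IsPieceSum.isZeroSumIn P Z hP hN) ihM ihN

/-- **The closure principle** («S4 on the pieces ⟹ S4 on every `Z`-multiset»).  Let the pieces `P` be `Z`-multisets whose
count vectors span `Z` (`hL`, Lemma L), with at least one piece, and let `Alg` be a predicate on multisets such that

* `hadd` (product closure, Lemma P (1)): `Alg M → Alg N → Alg (M + N)` for `Z`-multisets `M`, `N`;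
* `hcancel` (cancellation, Lemma P (2)–(3)): `Alg (M + N) → Alg N → Alg M` for `Z`-multisets `M`, `N`;
* `hpiece`: `Alg p` for every piece `p ∈ P`.

Then `Alg M` for EVERY `Z`-multiset `M`.  (The empty multiset is handled by cancellation against one piece.) -/
theorem alg_of_pieces (hP : ∀ p ∈ P, IsZeroSumIn Z p) (hL : Submodule.span ℤ (toVec '' P) = Z) (hne : P.Nonempty)
    (Alg : Multiset α → Prop)
    (hadd : ∀ M N, IsZeroSumIn Z M → IsZeroSumIn Z N → Alg M → Alg N → Alg (M + N))
    (hcancel : ∀ M N, IsZeroSumIn Z M → IsZeroSumIn Z N → Alg (M + N) → Alg N → Alg M)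
    (hpiece : ∀ p ∈ P, Alg p)
    (M : Multiset α) (hM : IsZeroSumIn Z M) : Alg M := by
  have hzero : Alg 0 := by
    obtain ⟨p, hp⟩ := hne
    exact hcancel 0 p (isZeroSumIn_zero Z) (hP p hp) (by simpa using hpiece p hp) (hpiece p hp)
  obtain ⟨N, hN, hMN⟩ := exists_pieces_add_pieces P Z hL hM
  exact hcancel M N hM (IsPieceSum.isZeroSumIn P Z hP hN) (alg_of_isPieceSum P Z hP Alg hadd hzero hpiece hMN)
    (alg_of_isPieceSum P Z hP Alg hadd hzero hpiece hN)

end HodgeRepro.Night3.Abstract
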